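import Mathlib
import HarnessLib
import Literature.Combinatorics.Additive.EnergyIntersectionInequalities

/-!
# `A + B` versus `A − B`: Grynkiewicz's lower bound for `|A + B|` from few repeated differences
# (Grynkiewicz 2009, «A step beyond Kemperman's structure theorem», §3, Theorem 3.1)

Topic `Literature/Combinatorics/Additive`.  Cell `mm-stpp` (D-0046), seat `mm-stpp-lit` (gen 21): the
first section file of the port of [Grynkiewicz2009] (KST+1, the composite-order extension of the
Hamidoune–Rødseth theorem; LIT-INDEX §26).  Section 3 of the paper is self-contained: it converts the
hypothesis «every difference outside a small set `T` has at most `k` representations in `A − B`» into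
lower bounds for `|A + B|` (and for `|T|`), through the identity `|E(M(A, B))| = |E(M(A, −B))|`
(= the symmetry `E(A, B) = E(A, −B)` of additive energy, already in the tree as
`Literature.Combinatorics.Additive.addEnergy_neg_right`) and the two extremal facts «for fixed `|A + B|`
the number of coincidences is minimised by representation counts as equal as possible, and under caps it
is maximised by filling the largest caps first» (print p. 8, after (7)).  The main proof of the paper uses
Theorem 3.1 (ii) with `k = 1` and (iii) in its Case 3 (`|B(e)| = 1` for every Dyson transform).

**Theorem 3.1 (as printed).**  «Let `A`, `B` and `T` be finite subsets of an abelian group `G`, with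
`|A| ≥ |B| > k ≥ 1` and `|A| ≥ |T|`, such that `r_{A,−B}(x) ≤ k` for all `x ∈ G ∖ T`.  Then the following
bounds hold:
(i) `|A + B| ≥ |A|²|B|²/(M + |A||B|) ≥ |A|²|B|/(|T|(|B| − k) + k|A|)`,
(ii) `|T| ≥ (|A|²|B|² − δ₀² − |A + B|(k|A||B| − δ₀ − δ(k − δ)))/(|A + B||B|(|B| − k))
      ≥ (|A|²|B|² − δ₀² − |A + B|(k|A||B| − δ₀))/(|A + B||B|(|B| − k)) ≥ |A|(|A||B| − k|A + B|)/(|A + B|(|B| − k))`,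
(iii) `|A + B| ≥ 2|A||B|/⌊(M + 2|A||B|)/|A||B|⌋ − M/(⌊(M + |A||B|)/|A||B|⌋⌊(M + 2|A||B|)/|A||B|⌋)
      = |A|²|B|²(M + 2x)/((M + |A||B| + x)(M + x))`,
where `δ` is the integer such that `|B|(|A| − |T|) ≡ δ mod k` with `0 ≤ δ < k`, where
`M = |T||B|(|B| − k) + (k − 1)|A||B| − δ(k − δ)`, where `x` is the integer, `1 ≤ x ≤ |A||B|`, such that
`M + x ≡ 0 mod |A||B|`, and where `δ₀` is the integer such that `|A||B| + δ₀ ≡ 0 mod |A + B|` with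
`0 ≤ δ₀ < |A + B|`.» [cite: Grynkiewicz2009, Thm 3.1]

Here `r_{A,−B}(x) = |{(a, b) ∈ A × B : a − b = x}|` is Mathlib's `A.addConvolution (-B) x`
(`= #(A ∩ (x +ᵥ B))`, `Finset.card_inter_vadd`).

## What is proved, and in which form

* The two extremal facts behind (8) and (10)–(11) of the printed proof, as statements about a capped
  function `f : ι → ℕ` on a finset: `sum_sq_le_div_mul_sq_add_mod_sq` (one cap),
  `sum_sq_le_greedy` (caps `b` on `T`, `k ≤ b` off `T`: «as many cliques of largest allowed size as
  possible»), `two_mul_add_one_mul_sum_le_sum_sq_add` («as near equal a size as possible», in the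
  tangent-line form valid for EVERY integer level `d`, which is what makes (iii) hold for every `d`).
* (8): `addEnergy_le_of_addConvolution_neg_le` —
  `E(A, B) ≤ |T||B|² + q k² + δ²` with `q k + δ = |A||B| − |T||B|`, `0 ≤ δ < k`; the right side equals the
  printed `M + |A||B|` (`cast_greedyBound_eq` over `ℤ`, `cast_greedyBound_eq_M_add` over `ℝ`; `0 ≤ M` is
  `printedM_nonneg`).  Hypotheses needed: only `k ≤ |B|` and `|T| ≤ |A|` (the printed
  `|A| ≥ |B| > k ≥ 1` only makes `M` the right cap count and `M ≥ 0`; we keep the printed hypotheses in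
  the ℝ-valued restatements).  The hypothesis may be given as `|A ∩ (x + B)| ≤ k`
  (`addConvolution_neg_le_of_card_inter_vadd_le`).
* (10)/(11) for every level: `two_mul_add_one_mul_card_mul_card_le` —
  `(2d + 1)|A||B| ≤ E(A, B) + |A + B| d(d + 1)` for all `d : ℕ`, and its integrality refinement at the
  level `d = (|A||B| + δ₀)/|A + B| − 1`: `card_sq_mul_card_sq_add_le` —
  `|A|²|B|² + |A + B| δ₀ ≤ |A + B| E(A, B) + δ₀²` (Cauchy–Schwarz `Finset.le_card_add_mul_addEnergy`
  sharpened by the divisibility defect `δ₀`; valid for all finite `A`, `B`).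
* Theorem 3.1 in cleared-denominator ℕ form: (i) `thm31_i`, `thm31_i_weak`; (ii) `thm31_ii`;
  (iii) `thm31_iii` (every `d`); and AS PRINTED over `ℝ`: `thm31_i_real`, `thm31_i_real'`,
  `thm31_ii_real` (+ the two weaker printed forms `thm31_ii_real'`, `thm31_ii_real''`),
  `thm31_iii_real` (every `d ≥ 1`; the printed display is the instance `d = ⌊(M + |A||B|)/|A||B|⌋`,
  `thm31_iii_real_floor`).
* The §3 opening remark: a Sidon set `A` (spelled out as `a + b = c + d → a = c ∨ a = d`, as in
  `SidonSetsErdosTuran`) has `|A + A| ≥ |A|(|A| + 1)/2` — `card_mul_succ_le_two_mul_card_add_of_sidon`.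

DEVIATIONS.  (a) We do not transcribe the graph `M(A, B)` / line-graph language of the arXiv version's
Proposition 3.2 (print keeps only the identity (7)); (7) is `addEnergy_neg_right` and its unordered form
`sum_choose_two_addConvolution_eq`.  (b) In (iii) we prove the bound for every `d ≥ 1`
(print: (14) `|A+B| ≥ min{|A||B|/d, 2|A||B|/(d+1) − M/(d(d+1))}` for every `d`, then optimised); the
tangent-line argument makes the first member of the printed minimum unnecessary, so our `thm31_iii_real`
is formally stronger than (14) and specialises to the printed (iii).  The closed form in `x` is recorded
as the algebraic identity `thm31_iii_closed_form` under its defining congruence.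
WHAT THIS FILE IS NOT: nothing of §§4–5 (Theorem 4.1, the quasi-periodic vocabulary) is here; no new
definitions, no named facts.

## References
* D. J. Grynkiewicz, *A step beyond Kemperman's structure theorem*, Mathematika 55 (2009) 67–114,
  doi:10.1112/S0025579300000966, §3, Theorem 3.1 and displays (6)–(14) (held
  `paper:doi-10-1112-s0025579300000966`, pp. 7–9 read 2026-08-28; arXiv:0710.1041 §3 = Theorem 3.1,
  Proposition 3.2, held `paper:arxiv-0710.1041` chunks p0008–p0010) [cite: Grynkiewicz2009, Thm 3.1].
* T. Tao, V. Vu, *Additive Combinatorics*, CUP (2006), §2.3 — additive energy, `E(A,B) = E(A,−B)`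
  [cite: TaoVu2006, §2.3].
-/

namespace Literature.Combinatorics.Additive.Grynkiewicz2009

open Finset
open scoped Pointwise _root_.Combinatorics.Additive

/-! ### §3-A.  The two extremal facts about representation counts (print p. 8, after (7)) -/

section Extremal
variable {ι : Type*}

/-- Subadditivity modulo `k` of `w ↦ w (k − w)`: for `u ≤ k`, `v < k`,
`((u+v) mod k)(k − (u+v) mod k) ≤ u(k − u) + v(k − v)`. [folklore] -/
private theorem mod_mul_sub_le_add (k u v : ℕ) (hu : u ≤ k) (hv : v < k) :
    (u + v) % k * (k - (u + v) % k) ≤ u * (k - u) + v * (k - v) := by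
  obtain ⟨p, hp⟩ : ∃ p, k = u + p := ⟨k - u, by omega⟩
  obtain ⟨q, hq⟩ : ∃ q, k = v + q := ⟨k - v, by omega⟩
  have hku : k - u = p := by omega
  have hkv : k - v = q := by omega
  rw [hku, hkv]
  by_cases h : u + v < k
  · rw [Nat.mod_eq_of_lt h]
    have : k - (u + v) = p - v := by omega
    rw [this]
    have hvp : v ≤ p := by omega
    obtain ⟨w, hw⟩ : ∃ w, p = v + w := ⟨p - v, by omega⟩
    have : p - v = w := by omega
    rw [this]
    subst hw
    nlinarith
  · push Not at h
    have h1 : (u + v) % k = u + v - k := by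
      rw [Nat.mod_eq_sub_mod h, Nat.mod_eq_of_lt (by omega)]
    rw [h1]
    obtain ⟨w, hw⟩ : ∃ w, u + v = k + w := ⟨u + v - k, by omega⟩
    have h2 : u + v - k = w := by omega
    rw [h2]
    have hp' : p = v - w := by omega
    have hq' : q = u - w := by omega
    obtain ⟨p', hp''⟩ : ∃ p', v = w + p' := ⟨v - w, by omega⟩
    obtain ⟨q', hq''⟩ : ∃ q', u = w + q' := ⟨u - w, by omega⟩
    have : k - w = p' + q' := by omega
    rw [this, hp', hq']
    have e1 : v - w = p' := by omega
    have e2 : u - w = q' := by omega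
    rw [e1, e2, hq'', hp'']
    nlinarith

/-- The residue defect of a `k`-capped function: if `f ≤ k` on `s` and `δ = (Σ_s f) mod k`, then
`δ (k − δ) ≤ Σ_{x ∈ s} f(x)(k − f(x))` (so a capped function whose total is not a multiple of `k`
cannot consist of full and empty values only). [cite: Grynkiewicz2009, §3, display (8)] -/
theorem mod_mul_sub_mod_le_sum [DecidableEq ι] (s : Finset ι) (f : ι → ℕ) (k : ℕ)
    (hf : ∀ x ∈ s, f x ≤ k) :
    (∑ x ∈ s, f x) % k * (k - (∑ x ∈ s, f x) % k) ≤ ∑ x ∈ s, f x * (k - f x) := by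
  induction s using Finset.induction_on with
  | empty => simp
  | insert a s ha ih =>
    rw [sum_insert ha, sum_insert ha]
    have hfa : f a ≤ k := hf a (mem_insert_self a s)
    have ih' := ih fun x hx => hf x (mem_insert_of_mem hx)
    rcases Nat.eq_zero_or_pos k with hk | hk
    · subst hk
      simp
    have hv : (∑ x ∈ s, f x) % k < k := Nat.mod_lt _ hk
    calc (f a + ∑ x ∈ s, f x) % k * (k - (f a + ∑ x ∈ s, f x) % k)
        = (f a + (∑ x ∈ s, f x) % k) % k * (k - (f a + (∑ x ∈ s, f x) % k) % k) := by
          rw [Nat.add_mod_mod]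
      _ ≤ f a * (k - f a) + (∑ x ∈ s, f x) % k * (k - (∑ x ∈ s, f x) % k) :=
          mod_mul_sub_le_add k _ _ hfa hv
      _ ≤ f a * (k - f a) + ∑ x ∈ s, f x * (k - f x) := by gcongr

/-- One cap: if `f ≤ k` on `s` and `S = Σ_s f`, then `Σ_s f² ≤ ⌊S/k⌋ k² + (S mod k)²` — the sum of
squares is largest when all values but one are `k` or `0`. [cite: Grynkiewicz2009, §3, display (8)] -/
theorem sum_sq_le_div_mul_sq_add_mod_sq [DecidableEq ι] (s : Finset ι) (f : ι → ℕ) (k : ℕ)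
    (hf : ∀ x ∈ s, f x ≤ k) :
    ∑ x ∈ s, f x ^ 2 ≤ (∑ x ∈ s, f x) / k * k ^ 2 + ((∑ x ∈ s, f x) % k) ^ 2 := by
  set S := ∑ x ∈ s, f x with hS
  have h1 : ∑ x ∈ s, f x ^ 2 + ∑ x ∈ s, f x * (k - f x) = k * S := by
    rw [hS, mul_sum, ← sum_add_distrib]
    refine sum_congr rfl fun x hx => ?_
    have := hf x hx
    obtain ⟨w, hw⟩ : ∃ w, k = f x + w := ⟨k - f x, by omega⟩
    rw [hw, Nat.add_sub_cancel_left]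
    ring
  have h2 := mod_mul_sub_mod_le_sum s f k hf
  rw [← hS] at h2
  have h3 : k * S = S / k * k ^ 2 + (S % k) ^ 2 + S % k * (k - S % k) := by
    have hdm := Nat.div_add_mod S k
    rcases Nat.eq_zero_or_pos k with hk | hk
    · subst hk
      have hS0 : S = 0 := by
        rw [hS]; exact sum_eq_zero fun x hx => Nat.le_zero.1 (hf x hx)
      simp [hS0]
    have hlt : S % k ≤ k := (Nat.mod_lt S hk).le
    obtain ⟨w, hw⟩ : ∃ w, k = S % k + w := ⟨k - S % k, by omega⟩
    have : k - S % k = w := by omega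
    rw [this]
    set q := S / k
    set d := S % k
    calc k * S = k * (k * q + d) := by rw [hdm]
      _ = q * k ^ 2 + d * k := by ring
      _ = q * k ^ 2 + d * (d + w) := by rw [← hw]
      _ = q * k ^ 2 + d ^ 2 + d * w := by ring
  omega

/-- The exchange inequality: moving `m ≤ r` units onto a value `p` with `r ≤ p + m` does not decrease
the sum of squares. [folklore] -/
private theorem sq_add_sq_le_exchange (p r m : ℕ) (hmr : m ≤ r) (hr : r ≤ p + m) :
    p ^ 2 + r ^ 2 ≤ (p + m) ^ 2 + (r - m) ^ 2 := by
  obtain ⟨s, rfl⟩ : ∃ s, r = m + s := ⟨r - m, by omega⟩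
  rw [Nat.add_sub_cancel_left]
  nlinarith

/-- Two caps («as many cliques of largest allowed size as possible, followed by as many cliques of the
next largest allowed size as possible»): if `f ≤ b` on `U`, `f ≤ k` on `U ∖ T` with `k ≤ b`, and the
total `Σ_U f` is at least `|T| b`, then `Σ_U f² ≤ |T| b² + ⌊S/k⌋ k² + (S mod k)²` where
`S = Σ_U f − |T| b`.  Proof: exchange argument (fill `T` first), then the one-cap bound off `T`.
[cite: Grynkiewicz2009, §3, display (8)] -/
theorem sum_sq_le_greedy [DecidableEq ι] (U T : Finset ι) (hTU : T ⊆ U)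
    (b k : ℕ) (hkb : k ≤ b) (f : ι → ℕ)
    (hfb : ∀ x ∈ U, f x ≤ b) (hfk : ∀ x ∈ U, x ∉ T → f x ≤ k)
    (hN : #T * b ≤ ∑ x ∈ U, f x) :
    ∑ x ∈ U, f x ^ 2 ≤
      #T * b ^ 2 + ((∑ x ∈ U, f x) - #T * b) / k * k ^ 2 + (((∑ x ∈ U, f x) - #T * b) % k) ^ 2 := by
  suffices key : ∀ (D : ℕ) (f : ι → ℕ), (∀ x ∈ U, f x ≤ b) → (∀ x ∈ U, x ∉ T → f x ≤ k) →
      #T * b ≤ ∑ x ∈ U, f x → #T * b - ∑ x ∈ T, f x = D →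
      ∑ x ∈ U, f x ^ 2 ≤ #T * b ^ 2 + ((∑ x ∈ U, f x) - #T * b) / k * k ^ 2
        + (((∑ x ∈ U, f x) - #T * b) % k) ^ 2 from key _ f hfb hfk hN rfl
  intro D
  induction D using Nat.strong_induction_on with
  | _ D ih =>
  intro f hfb hfk hN hD
  have hsdiff : ∑ x ∈ U \ T, f x + ∑ x ∈ T, f x = ∑ x ∈ U, f x := sum_sdiff hTU
  have hsdiff2 : ∑ x ∈ U \ T, f x ^ 2 + ∑ x ∈ T, f x ^ 2 = ∑ x ∈ U, f x ^ 2 := sum_sdiff hTU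
  have hST : ∑ x ∈ T, f x ≤ #T * b := by
    have := Finset.sum_le_card_nsmul T f b (fun x hx => hfb x (hTU hx))
    simpa using this
  rcases Nat.eq_or_lt_of_le hST with heq | hlt
  · -- every point of `T` is full: split off `T` and use the one-cap bound on `U \ T`
    have hfull : ∀ x ∈ T, f x = b := by
      by_contra hcon
      push Not at hcon
      obtain ⟨x, hxT, hx⟩ := hcon
      have hlt : ∑ x ∈ T, f x < ∑ _x ∈ T, b :=
        sum_lt_sum (fun y hy => hfb y (hTU hy)) ⟨x, hxT, lt_of_le_of_ne (hfb x (hTU hxT)) hx⟩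
      rw [sum_const, smul_eq_mul] at hlt
      omega
    have hT2 : ∑ x ∈ T, f x ^ 2 = #T * b ^ 2 := by
      rw [sum_congr rfl (g := fun _ => b ^ 2) (fun x hx => by rw [hfull x hx]), sum_const,
        smul_eq_mul]
    have hoff := sum_sq_le_div_mul_sq_add_mod_sq (U \ T) f k
      (fun x hx => hfk x (mem_sdiff.1 hx).1 (mem_sdiff.1 hx).2)
    have hS : (∑ x ∈ U, f x) - #T * b = ∑ x ∈ U \ T, f x := by omega
    rw [hS, ← hsdiff2, hT2]
    omega
  · -- positive deficit: move mass from an off-`T` point `y` to a non-full point `x0 ∈ T`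
    obtain ⟨x0, hx0T, hx0⟩ : ∃ x0 ∈ T, f x0 < b := by
      apply exists_lt_of_sum_lt
      rw [sum_const, smul_eq_mul]
      exact hlt
    have hSpos : ∑ x ∈ U \ T, f x ≠ 0 := by omega
    obtain ⟨y, hyUT, hy⟩ := exists_ne_zero_of_sum_ne_zero hSpos
    rw [mem_sdiff] at hyUT
    have hne : x0 ≠ y := fun h => hyUT.2 (h ▸ hx0T)
    have hyk : f y ≤ k := hfk y hyUT.1 hyUT.2
    set m := min (f y) (b - f x0) with hm
    have hm0 : 0 < m := by
      rw [hm]; exact lt_min (Nat.pos_of_ne_zero hy) (by omega)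
    have hmy : m ≤ f y := min_le_left _ _
    have hmx : f x0 + m ≤ b := by
      have := min_le_right (f y) (b - f x0); omega
    let g : ι → ℕ := Function.update (Function.update f x0 (f x0 + m)) y (f y - m)
    have hgy : g y = f y - m := by simp [g]
    have hgx0 : g x0 = f x0 + m := by simp [g, Function.update, hne]
    have hgz : ∀ z, z ≠ x0 → z ≠ y → g z = f z := fun z h1 h2 => by
      simp [g, Function.update, h1, h2]
    have hx0U : x0 ∈ U := hTU hx0T
    have hx0U' : x0 ∈ U \ {y} := mem_sdiff.2 ⟨hx0U, by simpa using hne⟩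
    -- sums over `U`
    have hdecomp : ∀ φ : ι → ℕ, U.sum φ = φ y + (φ x0 + ((U \ {y}) \ {x0}).sum φ) := by
      intro φ
      rw [sum_eq_add_sum_sdiff_singleton_of_mem hyUT.1 φ,
        sum_eq_add_sum_sdiff_singleton_of_mem hx0U' φ]
    have hrest : ∀ x ∈ (U \ {y}) \ {x0}, g x = f x := by
      intro x hx
      simp only [mem_sdiff, mem_singleton] at hx
      exact hgz x hx.2 hx.1.2
    have hsumU : ∑ x ∈ U, g x = ∑ x ∈ U, f x := by
      rw [hdecomp g, hdecomp f, hgy, hgx0, sum_congr rfl hrest]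
      have : m ≤ f y := hmy
      omega
    have hrest2 : ∑ x ∈ (U \ {y}) \ {x0}, g x ^ 2 = ∑ x ∈ (U \ {y}) \ {x0}, f x ^ 2 :=
      sum_congr rfl fun x hx => by rw [hrest x hx]
    have hsumU2 : ∑ x ∈ U, f x ^ 2 ≤ ∑ x ∈ U, g x ^ 2 := by
      rw [hdecomp (fun x => g x ^ 2), hdecomp (fun x => f x ^ 2), hgy, hgx0, hrest2]
      have := sq_add_sq_le_exchange (f x0) (f y) m hmy (by
        rcases min_choice (f y) (b - f x0) with h | h
        · omega
        · omega)
      omega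
    -- sums over `T` (`y ∉ T`)
    have hTdecomp : ∀ φ : ι → ℕ, T.sum φ = φ x0 + (T \ {x0}).sum φ := fun φ =>
      sum_eq_add_sum_sdiff_singleton_of_mem hx0T φ
    have hTrest : ∀ x ∈ T \ {x0}, g x = f x := by
      intro x hx
      simp only [mem_sdiff, mem_singleton] at hx
      exact hgz x hx.2 (fun h => hyUT.2 (h ▸ hx.1))
    have hsumT : ∑ x ∈ T, g x = ∑ x ∈ T, f x + m := by
      rw [hTdecomp g, hTdecomp f, hgx0, sum_congr rfl hTrest]
      ring
    -- the hypotheses are inherited by `g`, with a smaller deficit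
    have hgb : ∀ x ∈ U, g x ≤ b := by
      intro x hx
      by_cases h1 : x = x0
      · subst h1; rw [hgx0]; exact hmx
      by_cases h2 : x = y
      · subst h2; rw [hgy]; exact le_trans (Nat.sub_le _ _) (hyk.trans hkb)
      rw [hgz x h1 h2]; exact hfb x hx
    have hgk : ∀ x ∈ U, x ∉ T → g x ≤ k := by
      intro x hx hxT
      have h1 : x ≠ x0 := fun h => hxT (h ▸ hx0T)
      by_cases h2 : x = y
      · subst h2; rw [hgy]; exact le_trans (Nat.sub_le _ _) hyk
      rw [hgz x h1 h2]; exact hfk x hx hxT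
    have hgN : #T * b ≤ ∑ x ∈ U, g x := by rw [hsumU]; exact hN
    have hgD : #T * b - ∑ x ∈ T, g x < D := by rw [hsumT]; omega
    have := ih _ hgD g hgb hgk hgN rfl
    rw [hsumU] at this
    exact hsumU2.trans this

/-- Tangent line of `r ↦ r²` between consecutive integers: `(2d + 1) r ≤ r² + d(d + 1)`
(equality iff `r ∈ {d, d + 1}`). [folklore] -/
private theorem two_mul_add_one_mul_le_sq_add (r d : ℕ) : (2 * d + 1) * r ≤ r ^ 2 + d * (d + 1) := by
  rcases le_or_gt r d with h | h
  · obtain ⟨e, rfl⟩ : ∃ e, d = r + e := ⟨d - r, by omega⟩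
    nlinarith
  · obtain ⟨e, rfl⟩ : ∃ e, r = d + 1 + e := ⟨r - d - 1, by omega⟩
    nlinarith

/-- «Cliques of as near equal a size as possible»: for every level `d`,
`(2d + 1) Σ_s f ≤ Σ_s f² + |s| d(d + 1)`; i.e. among functions on `s` with a given total, the sum
of squares is least when all values are `d` or `d + 1`. [cite: Grynkiewicz2009, §3, displays (10)–(11)] -/
theorem two_mul_add_one_mul_sum_le_sum_sq_add (s : Finset ι) (f : ι → ℕ) (d : ℕ) :
    (2 * d + 1) * ∑ x ∈ s, f x ≤ ∑ x ∈ s, f x ^ 2 + #s * (d * (d + 1)) := by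
  rw [mul_sum, card_eq_sum_ones, sum_mul, ← sum_add_distrib]
  exact sum_le_sum fun x _ => by simpa using two_mul_add_one_mul_le_sq_add (f x) d

end Extremal

/-! ### §3-B.  Energy as a sum of squared representation counts; the identity (7) -/

section Energy
variable {G : Type*} [AddCommGroup G] [DecidableEq G]

/-- `E(A, B) = Σ_{x ∈ A + B} r_{A,B}(x)²` in terms of Mathlib's `addConvolution` (display (6):
`|A + B| = Σ nᵢ`, `|E(M(A,B))| = Σ nᵢ C(i, 2)`). [cite: Grynkiewicz2009, §3, display (6)] -/
theorem addEnergy_eq_sum_addConvolution_sq (A B : Finset G) :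
    E[A, B] = ∑ x ∈ A + B, A.addConvolution B x ^ 2 := by
  rw [addEnergy_eq_sum_sq']
  rfl

/-- `E(A, B) = Σ_{x ∈ A − B} r_{A,−B}(x)²` — display (7), `|E(M(A, B))| = |E(M(A, −B))|`, in energy
form (the tree's `addEnergy_neg_right`). [cite: Grynkiewicz2009, §3, display (7)] -/
theorem addEnergy_eq_sum_addConvolution_neg_sq (A B : Finset G) :
    E[A, B] = ∑ x ∈ A - B, A.addConvolution (-B) x ^ 2 := by
  rw [← Literature.Combinatorics.Additive.addEnergy_neg_right, addEnergy_eq_sum_addConvolution_sq,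
    sub_eq_add_neg]

/-- Display (7) as printed, for the number of EDGES of the graphs `M(A, B)`, `M(A, −B)` (unordered
coincident pairs): `Σ_{x ∈ A+B} C(r_{A,B}(x), 2) = Σ_{x ∈ A−B} C(r_{A,−B}(x), 2)`.
[cite: Grynkiewicz2009, §3, display (7)] -/
theorem sum_choose_two_addConvolution_eq (A B : Finset G) :
    ∑ x ∈ A + B, (A.addConvolution B x).choose 2 =
      ∑ x ∈ A - B, (A.addConvolution (-B) x).choose 2 := by
  have h1 := addEnergy_eq_sum_addConvolution_sq A B
  have h2 := addEnergy_eq_sum_addConvolution_neg_sq A B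
  have hs1 := Literature.Combinatorics.Additive.sum_addConvolution A B
  have hs2 : ∑ x ∈ A - B, A.addConvolution (-B) x = #A * #B := by
    rw [sub_eq_add_neg, Literature.Combinatorics.Additive.sum_addConvolution, card_neg]
  -- `2 Σ C(r,2) = Σ r² − Σ r` on both sides
  have key : ∀ (s : Finset G) (f : G → ℕ),
      2 * ∑ x ∈ s, (f x).choose 2 + ∑ x ∈ s, f x = ∑ x ∈ s, f x ^ 2 := by
    intro s f
    rw [mul_sum, ← sum_add_distrib]
    refine sum_congr rfl fun x _ => ?_
    have := Nat.choose_two_right (f x)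
    rcases Nat.even_or_odd (f x) with ⟨m, hm⟩ | ⟨m, hm⟩
    · rw [Nat.choose_two_right, hm]
      rcases m with _ | m
      · simp
      · have : (m + 1 + (m + 1)) * (m + 1 + (m + 1) - 1) / 2 = (m + 1) * (2 * m + 1) := by
          rw [show m + 1 + (m + 1) - 1 = 2 * m + 1 by omega]
          rw [show (m + 1 + (m + 1)) * (2 * m + 1) = ((m + 1) * (2 * m + 1)) * 2 by ring]
          exact Nat.mul_div_cancel _ two_pos
        rw [this]; ring
    · rw [Nat.choose_two_right, hm]
      have : (2 * m + 1) * (2 * m + 1 - 1) / 2 = (2 * m + 1) * m := by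
        rw [show 2 * m + 1 - 1 = 2 * m by omega,
          show (2 * m + 1) * (2 * m) = ((2 * m + 1) * m) * 2 by ring]
        exact Nat.mul_div_cancel _ two_pos
      rw [this]; ring
  have k1 := key (A + B) (A.addConvolution B)
  have k2 := key (A - B) (A.addConvolution (-B))
  omega

/-- «As equal as possible» for the sumset: for every level `d`,
`(2d + 1)|A||B| ≤ E(A, B) + |A + B| d(d + 1)` (displays (10)–(11), for every `d` rather than only
`d = ⌈|A||B|/|A + B|⌉ − 1`). [cite: Grynkiewicz2009, §3, displays (10)–(11)] -/
theorem two_mul_add_one_mul_card_mul_card_le (A B : Finset G) (d : ℕ) :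
    (2 * d + 1) * (#A * #B) ≤ E[A, B] + #(A + B) * (d * (d + 1)) := by
  rw [← Literature.Combinatorics.Additive.sum_addConvolution, addEnergy_eq_sum_addConvolution_sq]
  exact two_mul_add_one_mul_sum_le_sum_sq_add _ _ d

/-- `|A + B| ≤ |A||B|`. [folklore] -/
private theorem card_add_le_card_mul_card (A B : Finset G) : #(A + B) ≤ #A * #B := by
  rw [← card_product]
  exact card_le_card_of_surjOn (fun p => p.1 + p.2) fun x hx => by
    obtain ⟨a, ha, b, hb, rfl⟩ := mem_add.1 (mem_coe.1 hx)
    exact ⟨(a, b), mem_coe.2 (mem_product.2 ⟨ha, hb⟩), rfl⟩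

/-- Display (12) in energy form — Cauchy–Schwarz `|A|²|B|² ≤ |A + B| E(A, B)`
(`Finset.le_card_add_mul_addEnergy`) sharpened by the divisibility defect: if `0 ≤ δ₀ < |A + B|` and
`|A + B| ∣ |A||B| + δ₀`, then `|A|²|B|² + |A + B| δ₀ ≤ |A + B| E(A, B) + δ₀²`.
[cite: Grynkiewicz2009, §3, displays (9)–(10), (12)] -/
theorem card_sq_mul_card_sq_add_le (A B : Finset G) (δ₀ : ℕ) (hδ₀ : δ₀ < #(A + B))
    (hdiv : #(A + B) ∣ #A * #B + δ₀) :
    #A ^ 2 * #B ^ 2 + #(A + B) * δ₀ ≤ #(A + B) * E[A, B] + δ₀ ^ 2 := by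
  obtain ⟨m, hm⟩ := hdiv
  set c := #(A + B) with hc
  set N := #A * #B with hN
  have hcpos : 0 < c := by omega
  have hcN : c ≤ N := card_add_le_card_mul_card A B
  have hm1 : 1 ≤ m := by
    by_contra h
    have : m = 0 := by omega
    subst this; omega
  have h := two_mul_add_one_mul_card_mul_card_le A B (m - 1)
  rw [← hN, ← hc] at h
  obtain ⟨l, rfl⟩ : ∃ l, m = l + 1 := ⟨m - 1, by omega⟩
  simp only [add_tsub_cancel_right] at h
  have h1 : c * (l * (l + 1)) = l * (N + δ₀) := by rw [hm]; ring
  rw [h1] at h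
  have h3 : c * ((l + 1) * N) ≤ c * E[A, B] + c * l * δ₀ := by nlinarith
  have h5 : c * l + c = N + δ₀ := by rw [hm]; ring
  have hNδc : c ≤ N + δ₀ := by omega
  nlinarith [h3, h5, hNδc, hδ₀]

end Energy

/-! ### §3-C.  Theorem 3.1 -/

section Theorem31
variable {G : Type*} [AddCommGroup G] [DecidableEq G]

/-- **Display (8) (the energy bound).**  If `r_{A,−B}(x) ≤ k` for all `x ∉ T`, with `k ≤ |B|` and
`|T| ≤ |A|`, then `E(A, B) ≤ |T||B|² + q k² + δ²`, where `q = ⌊(|A||B| − |T||B|)/k⌋` and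
`δ = (|A||B| − |T||B|) mod k` — i.e. `2|E(M(A, −B))| ≤ M` with the printed
`M = |T||B|(|B| − k) + (k − 1)|A||B| − δ(k − δ)` (see `cast_greedyBound_eq`).
[cite: Grynkiewicz2009, Thm 3.1, proof, display (8)] -/
theorem addEnergy_le_of_addConvolution_neg_le (A B T : Finset G) (k : ℕ) (hkB : k ≤ #B)
    (hTA : #T ≤ #A) (hrep : ∀ x ∉ T, A.addConvolution (-B) x ≤ k) :
    E[A, B] ≤ #T * #B ^ 2 + (#A * #B - #T * #B) / k * k ^ 2 + ((#A * #B - #T * #B) % k) ^ 2 := by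
  classical
  set U : Finset G := (A - B) ∪ T with hU
  have hTU : T ⊆ U := subset_union_right
  have hzero : ∀ x ∈ U, x ∉ A - B → A.addConvolution (-B) x = 0 := by
    intro x _ hx
    rw [addConvolution_eq_zero, ← sub_eq_add_neg]
    exact hx
  have hsumU : ∑ x ∈ U, A.addConvolution (-B) x = #A * #B := by
    rw [← sum_subset subset_union_left (fun x hxU hx => hzero x hxU hx), sub_eq_add_neg,
      Literature.Combinatorics.Additive.sum_addConvolution, card_neg]
  have hsumU2 : ∑ x ∈ U, A.addConvolution (-B) x ^ 2 = E[A, B] := by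
    rw [addEnergy_eq_sum_addConvolution_neg_sq,
      ← sum_subset subset_union_left (fun x hxU hx => by rw [hzero x hxU hx]; simp)]
  have h := sum_sq_le_greedy U T hTU (#B) k hkB (A.addConvolution (-B))
    (fun x _ => (addConvolution_le_card_right).trans (card_neg B).le)
    (fun x _ hxT => hrep x hxT) (by rw [hsumU]; exact Nat.mul_le_mul_right _ hTA)
  rwa [hsumU, hsumU2] at h

/-- The hypothesis of Theorem 3.1 in the intersection form: `r_{A,−B}(x) = |A ∩ (x + B)|`
(`Finset.card_inter_vadd`), so «`|A ∩ (x + B)| ≤ k` off `T`» is the same hypothesis.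
[cite: Grynkiewicz2009, §2 (definition of `r_{A,B}`) and Thm 3.1] -/
theorem addConvolution_neg_le_of_card_inter_vadd_le {A B T : Finset G} {k : ℕ}
    (h : ∀ x ∉ T, #(A ∩ (x +ᵥ B)) ≤ k) : ∀ x ∉ T, A.addConvolution (-B) x ≤ k := fun x hx => by
  rw [← card_inter_vadd]; exact h x hx

/-- The greedy bound equals the printed `M + |A||B|`: with `q k + δ = |A||B| − |T||B|`, `δ < k`,
`1 ≤ k ≤ |B|`, `|T| ≤ |A|`:
`|T||B|² + q k² + δ² = |T||B|(|B| − k) + (k − 1)|A||B| − δ(k − δ) + |A||B|` (over `ℤ`).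
[cite: Grynkiewicz2009, Thm 3.1, proof, display (8)] -/
theorem cast_greedyBound_eq (a b t k : ℕ) (hk : 1 ≤ k) (hkb : k ≤ b) (hta : t ≤ a) :
    ((t * b ^ 2 + (a * b - t * b) / k * k ^ 2 + ((a * b - t * b) % k) ^ 2 : ℕ) : ℤ) =
      (t : ℤ) * b * ((b : ℤ) - k) + ((k : ℤ) - 1) * a * b
        - (((a * b - t * b) % k : ℕ) : ℤ) * ((k : ℤ) - (((a * b - t * b) % k : ℕ) : ℤ))
        + (a : ℤ) * b := by
  have hdm := Nat.div_add_mod (a * b - t * b) k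
  have htb : t * b ≤ a * b := Nat.mul_le_mul_right _ hta
  have hk1 : (1 : ℤ) ≤ k := by exact_mod_cast hk
  have hkb' : (k : ℤ) ≤ b := by exact_mod_cast hkb
  set q := (a * b - t * b) / k
  set δ := (a * b - t * b) % k
  have hq : (k : ℤ) * q + δ = (a : ℤ) * b - t * b := by
    have : ((k * q + δ : ℕ) : ℤ) = ((a * b - t * b : ℕ) : ℤ) := by rw [hdm]
    push_cast [htb] at this
    linarith
  push_cast
  linear_combination (k : ℤ) * hq

variable (A B T : Finset G) (k : ℕ)

/-- **Theorem 3.1 (i), cleared denominators.**  Under `r_{A,−B} ≤ k` off `T`, `k ≤ |B|`, `|T| ≤ |A|`: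
`|A|²|B|² ≤ |A + B| (|T||B|² + q k² + δ²)` (`= |A + B|(M + |A||B|)`, display (13)).
[cite: Grynkiewicz2009, Thm 3.1 (i)] -/
theorem thm31_i (hkB : k ≤ #B) (hTA : #T ≤ #A) (hrep : ∀ x ∉ T, A.addConvolution (-B) x ≤ k) :
    #A ^ 2 * #B ^ 2 ≤
      #(A + B) * (#T * #B ^ 2 + (#A * #B - #T * #B) / k * k ^ 2 + ((#A * #B - #T * #B) % k) ^ 2) :=
  (le_card_add_mul_addEnergy A B).trans
    (Nat.mul_le_mul_left _ (addEnergy_le_of_addConvolution_neg_le A B T k hkB hTA hrep))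

/-- **Theorem 3.1 (i), second (simpler) bound, cleared denominators:**
`|A|²|B| ≤ |A + B| (|T|(|B| − k) + k|A|)` (print: «for applications … not requiring such high accuracy,
the much simpler second bound in (i) may suffice»). [cite: Grynkiewicz2009, Thm 3.1 (i)] -/
theorem thm31_i_weak (hk : 1 ≤ k) (hkB : k ≤ #B) (hTA : #T ≤ #A)
    (hrep : ∀ x ∉ T, A.addConvolution (-B) x ≤ k) :
    #A ^ 2 * #B ≤ #(A + B) * (#T * (#B - k) + k * #A) := by
  have h := thm31_i A B T k hkB hTA hrep
  have hB : 0 < #B := lt_of_lt_of_le hk hkB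
  -- `|T||B|² + q k² + δ² ≤ |T||B|² + (q k + δ) k = |B| (|T|(|B| - k) + k |A|)`
  have hdm := Nat.div_add_mod (#A * #B - #T * #B) k
  set q := (#A * #B - #T * #B) / k
  set δ := (#A * #B - #T * #B) % k
  have hδk : δ < k := Nat.mod_lt _ hk
  have htb : #T * #B ≤ #A * #B := Nat.mul_le_mul_right _ hTA
  have e1 : #B * (#T * (#B - k) + k * #A) = #T * #B ^ 2 + k * (#A * #B - #T * #B) := by
    zify [hkB, htb]
    ring
  have hbound : #T * #B ^ 2 + q * k ^ 2 + δ ^ 2 ≤ #B * (#T * (#B - k) + k * #A) := by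
    rw [e1, ← hdm]
    nlinarith [hδk.le]
  have h2 := h.trans (Nat.mul_le_mul_left (#(A + B)) hbound)
  have h3 : #(A + B) * (#B * (#T * (#B - k) + k * #A)) =
      (#(A + B) * (#T * (#B - k) + k * #A)) * #B := by ring
  rw [h3, show #A ^ 2 * #B ^ 2 = (#A ^ 2 * #B) * #B by ring] at h2
  exact Nat.le_of_mul_le_mul_right h2 hB

/-- **Theorem 3.1 (iii), for every level, cleared denominators:** for all `d : ℕ`,
`(2d + 1)|A||B| ≤ |T||B|² + q k² + δ² + |A + B| d(d + 1)`, i.e. `2d|A||B| ≤ M + |A + B| d(d + 1)`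
(display (14), both members of the printed minimum at once). [cite: Grynkiewicz2009, Thm 3.1 (iii)] -/
theorem thm31_iii (hkB : k ≤ #B) (hTA : #T ≤ #A) (hrep : ∀ x ∉ T, A.addConvolution (-B) x ≤ k)
    (d : ℕ) :
    (2 * d + 1) * (#A * #B) ≤
      #T * #B ^ 2 + (#A * #B - #T * #B) / k * k ^ 2 + ((#A * #B - #T * #B) % k) ^ 2
        + #(A + B) * (d * (d + 1)) :=
  (two_mul_add_one_mul_card_mul_card_le A B d).trans
    (Nat.add_le_add_right (addEnergy_le_of_addConvolution_neg_le A B T k hkB hTA hrep) _)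

/-- **Theorem 3.1 (ii), cleared denominators:** with `δ₀` the integer, `0 ≤ δ₀ < |A + B|`, such that
`|A + B| ∣ |A||B| + δ₀`:  `|A|²|B|² + |A + B| δ₀ ≤ |A + B| (|T||B|² + q k² + δ²) + δ₀²`
(display (12) combined with (8)). [cite: Grynkiewicz2009, Thm 3.1 (ii)] -/
theorem thm31_ii (hkB : k ≤ #B) (hTA : #T ≤ #A) (hrep : ∀ x ∉ T, A.addConvolution (-B) x ≤ k)
    (δ₀ : ℕ) (hδ₀ : δ₀ < #(A + B)) (hdiv : #(A + B) ∣ #A * #B + δ₀) :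
    #A ^ 2 * #B ^ 2 + #(A + B) * δ₀ ≤
      #(A + B) * (#T * #B ^ 2 + (#A * #B - #T * #B) / k * k ^ 2 + ((#A * #B - #T * #B) % k) ^ 2)
        + δ₀ ^ 2 :=
  (card_sq_mul_card_sq_add_le A B δ₀ hδ₀ hdiv).trans (Nat.add_le_add_right
    (Nat.mul_le_mul_left _ (addEnergy_le_of_addConvolution_neg_le A B T k hkB hTA hrep)) _)

end Theorem31

/-! ### §3-D.  Theorem 3.1 as printed (over `ℝ`)

In this section `δ` and `M` are the printed quantities, passed as variables with their defining
equations `hδ : δ = |B|(|A| − |T|) mod k` and `hM : M = |T||B|(|B| − k) + (k − 1)|A||B| − δ(k − δ)`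
(instantiate with `rfl`). -/

section Printed
variable {G : Type*} [AddCommGroup G] [DecidableEq G]
variable (A B T : Finset G) (k : ℕ)

omit [AddCommGroup G] [DecidableEq G] in
/-- The ℕ-valued greedy bound casts to `M + |A||B|` (over `ℝ`), where
`δ = |B|(|A| − |T|) mod k` and `M = |T||B|(|B| − k) + (k − 1)|A||B| − δ(k − δ)` (only `|T| ≤ |A|`
is needed for this identity). [cite: Grynkiewicz2009, Thm 3.1] -/
theorem cast_greedyBound_eq_M_add (hTA : #T ≤ #A)
    (δ : ℕ) (hδ : δ = #B * (#A - #T) % k) (M : ℝ)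
    (hM : M = (#T : ℝ) * #B * (#B - k) + (k - 1) * #A * #B - δ * (k - δ)) :
    ((#T * #B ^ 2 + (#A * #B - #T * #B) / k * k ^ 2 + ((#A * #B - #T * #B) % k) ^ 2 : ℕ) : ℝ) =
      M + #A * #B := by
  have e : #A * #B - #T * #B = #B * (#A - #T) := by
    rw [Nat.mul_sub, mul_comm #B #A, mul_comm #B #T]
  have hdm := Nat.div_add_mod (#A * #B - #T * #B) k
  have htb : #T * #B ≤ #A * #B := Nat.mul_le_mul_right _ hTA
  rw [hM, hδ, ← e]
  set q := (#A * #B - #T * #B) / k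
  set d := (#A * #B - #T * #B) % k
  have hq : (k : ℝ) * q + d = (#A : ℝ) * #B - #T * #B := by
    have : ((k * q + d : ℕ) : ℝ) = ((#A * #B - #T * #B : ℕ) : ℝ) := by rw [hdm]
    push_cast [htb] at this
    linarith
  push_cast
  linear_combination (k : ℝ) * hq

omit [AddCommGroup G] [DecidableEq G] in
/-- `0 ≤ M` under the printed hypotheses (indeed `M ≥ 0`, print p. 8: «Thus `M ≥ 0`»).
[cite: Grynkiewicz2009, Thm 3.1, proof] -/
theorem printedM_nonneg (hk : 1 ≤ k) (hkB : k < #B) (hBA : #B ≤ #A)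
    (δ : ℕ) (hδ : δ = #B * (#A - #T) % k) (M : ℝ)
    (hM : M = (#T : ℝ) * #B * (#B - k) + (k - 1) * #A * #B - δ * (k - δ)) : 0 ≤ M := by
  have hδk : δ < k := by rw [hδ]; exact Nat.mod_lt _ hk
  have hB : (0 : ℝ) < #B := by exact_mod_cast (show 0 < #B by omega)
  have hkB' : (k : ℝ) + 1 ≤ #B := by exact_mod_cast hkB
  have hBA' : (#B : ℝ) ≤ #A := by exact_mod_cast hBA
  have hδk' : (δ : ℝ) + 1 ≤ k := by exact_mod_cast hδk
  have hk' : (1 : ℝ) ≤ k := by exact_mod_cast hk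
  have hδ0 : (0 : ℝ) ≤ δ := by positivity
  have h1 : (δ : ℝ) * (k - δ) ≤ (k - 1) * k := by nlinarith
  have hkab : (k : ℝ) ≤ #A * #B := by nlinarith
  have h2 : ((k : ℝ) - 1) * k ≤ (k - 1) * (#A * #B) :=
    mul_le_mul_of_nonneg_left hkab (by linarith)
  have h3 : (0 : ℝ) ≤ (#T : ℝ) * #B * (#B - k) := by
    have : (0 : ℝ) ≤ #B - k := by linarith
    positivity
  rw [hM]
  nlinarith

/-- **Theorem 3.1 (i) as printed:** `|A + B| ≥ |A|²|B|²/(M + |A||B|)`, with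
`M = |T||B|(|B| − k) + (k − 1)|A||B| − δ(k − δ)`, `δ = |B|(|A| − |T|) mod k`.
[cite: Grynkiewicz2009, Thm 3.1 (i)] -/
theorem thm31_i_real (hk : 1 ≤ k) (hkB : k < #B) (hBA : #B ≤ #A) (hTA : #T ≤ #A)
    (hrep : ∀ x ∉ T, A.addConvolution (-B) x ≤ k)
    (δ : ℕ) (hδ : δ = #B * (#A - #T) % k) (M : ℝ)
    (hM : M = (#T : ℝ) * #B * (#B - k) + (k - 1) * #A * #B - δ * (k - δ)) :
    (#A : ℝ) ^ 2 * #B ^ 2 / (M + #A * #B) ≤ #(A + B) := by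
  have h := thm31_i A B T k hkB.le hTA hrep
  have hcast := cast_greedyBound_eq_M_add A B T k hTA δ hδ M hM
  have hM0 := printedM_nonneg A B T k hk hkB hBA δ hδ M hM
  have hab : (0 : ℝ) < #A * #B := by
    have : 0 < #B := by omega
    have : 0 < #A := by omega
    positivity
  have hpos : 0 < M + #A * #B := by linarith
  rw [div_le_iff₀ hpos]
  have h' : ((#A ^ 2 * #B ^ 2 : ℕ) : ℝ) ≤ ((#(A + B) * (#T * #B ^ 2 + (#A * #B - #T * #B) / k * k ^ 2
      + ((#A * #B - #T * #B) % k) ^ 2) : ℕ) : ℝ) := by exact_mod_cast h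
  rw [Nat.cast_mul (#(A + B)), hcast] at h'
  push_cast at h'
  linarith

omit [AddCommGroup G] [DecidableEq G] in
/-- **Theorem 3.1 (i), second inequality as printed:**
`|A|²|B|²/(M + |A||B|) ≥ |A|²|B|/(|T|(|B| − k) + k|A|)` (since `M + |A||B| ≤ |B|(|T|(|B| − k) + k|A|)`).
[cite: Grynkiewicz2009, Thm 3.1 (i)] -/
theorem thm31_i_real' (hk : 1 ≤ k) (hkB : k < #B) (hBA : #B ≤ #A) (hTA : #T ≤ #A)
    (δ : ℕ) (hδ : δ = #B * (#A - #T) % k) (M : ℝ)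
    (hM : M = (#T : ℝ) * #B * (#B - k) + (k - 1) * #A * #B - δ * (k - δ)) :
    (#A : ℝ) ^ 2 * #B / (#T * (#B - k) + k * #A) ≤ (#A : ℝ) ^ 2 * #B ^ 2 / (M + #A * #B) := by
  have hM0 := printedM_nonneg A B T k hk hkB hBA δ hδ M hM
  have hδk : δ < k := by rw [hδ]; exact Nat.mod_lt _ hk
  have hB : (0 : ℝ) < #B := by exact_mod_cast (show 0 < #B by omega)
  have hA : (0 : ℝ) < #A := by exact_mod_cast (show 0 < #A by omega)
  have hkB' : (k : ℝ) < #B := by exact_mod_cast hkB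
  have hTA' : (#T : ℝ) ≤ #A := by exact_mod_cast hTA
  have hδk' : (δ : ℝ) ≤ k := by exact_mod_cast hδk.le
  have hk' : (1 : ℝ) ≤ k := by exact_mod_cast hk
  have hδ0 : (0 : ℝ) ≤ δ := by positivity
  have hD : (0 : ℝ) < #T * (#B - k) + k * #A := by nlinarith
  have hMle : M + #A * #B ≤ #B * (#T * (#B - k) + k * #A) := by
    rw [hM]
    nlinarith
  have hMpos : 0 < M + #A * #B := by nlinarith
  rw [div_le_div_iff₀ hD hMpos]
  have hA2B : (0 : ℝ) ≤ (#A : ℝ) ^ 2 * #B := by positivity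
  calc (#A : ℝ) ^ 2 * #B * (M + #A * #B)
      ≤ (#A : ℝ) ^ 2 * #B * (#B * (#T * (#B - k) + k * #A)) := mul_le_mul_of_nonneg_left hMle hA2B
    _ = (#A : ℝ) ^ 2 * #B ^ 2 * (#T * (#B - k) + k * #A) := by ring

/-- **Theorem 3.1 (ii) as printed (first inequality):**
`|T| ≥ (|A|²|B|² − δ₀² − |A + B|(k|A||B| − δ₀ − δ(k − δ)))/(|A + B||B|(|B| − k))`, with `δ₀` the
integer `0 ≤ δ₀ < |A + B|`, `|A||B| + δ₀ ≡ 0 mod |A + B|`, and `δ = |B|(|A| − |T|) mod k`.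
[cite: Grynkiewicz2009, Thm 3.1 (ii)] -/
theorem thm31_ii_real (hk : 1 ≤ k) (hkB : k < #B) (hTA : #T ≤ #A)
    (hrep : ∀ x ∉ T, A.addConvolution (-B) x ≤ k)
    (δ₀ : ℕ) (hδ₀ : δ₀ < #(A + B)) (hdiv : #(A + B) ∣ #A * #B + δ₀)
    (δ : ℕ) (hδ : δ = #B * (#A - #T) % k) :
    ((#A : ℝ) ^ 2 * #B ^ 2 - δ₀ ^ 2 - #(A + B) * (k * #A * #B - δ₀ - δ * (k - δ)))
        / (#(A + B) * #B * (#B - k)) ≤ #T := by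
  have h := thm31_ii A B T k hkB.le hTA hrep δ₀ hδ₀ hdiv
  have hcast := cast_greedyBound_eq_M_add A B T k hTA δ hδ _ rfl
  have hB : (0 : ℝ) < #B := by exact_mod_cast (show 0 < #B by omega)
  have hkB' : (k : ℝ) < #B := by exact_mod_cast hkB
  have hc : (0 : ℝ) < #(A + B) := by exact_mod_cast (show 0 < #(A + B) by omega)
  have hD : (0 : ℝ) < #(A + B) * #B * (#B - k) := by
    have : (0 : ℝ) < #B - k := by linarith
    positivity
  rw [div_le_iff₀ hD]
  have h' : ((#A ^ 2 * #B ^ 2 + #(A + B) * δ₀ : ℕ) : ℝ) ≤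
      ((#(A + B) * (#T * #B ^ 2 + (#A * #B - #T * #B) / k * k ^ 2 + ((#A * #B - #T * #B) % k) ^ 2)
        + δ₀ ^ 2 : ℕ) : ℝ) := by exact_mod_cast h
  rw [Nat.cast_add (#(A + B) * _), Nat.cast_mul (#(A + B)), hcast] at h'
  push_cast at h'
  nlinarith [h']

/-- **Theorem 3.1 (ii), second printed inequality** (drop `δ(k − δ) ≥ 0`).
[cite: Grynkiewicz2009, Thm 3.1 (ii)] -/
theorem thm31_ii_real' (hk : 1 ≤ k) (hkB : k < #B) (hc : 0 < #(A + B)) (δ₀ : ℕ)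
    (δ : ℕ) (hδ : δ = #B * (#A - #T) % k) :
    ((#A : ℝ) ^ 2 * #B ^ 2 - δ₀ ^ 2 - #(A + B) * (k * #A * #B - δ₀))
        / (#(A + B) * #B * (#B - k)) ≤
      ((#A : ℝ) ^ 2 * #B ^ 2 - δ₀ ^ 2 - #(A + B) * (k * #A * #B - δ₀ - δ * (k - δ)))
        / (#(A + B) * #B * (#B - k)) := by
  have hB : (0 : ℝ) < #B := by exact_mod_cast (show 0 < #B by omega)
  have hkB' : (k : ℝ) < #B := by exact_mod_cast hkB
  have hc' : (0 : ℝ) < #(A + B) := by exact_mod_cast hc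
  have hD : (0 : ℝ) ≤ #(A + B) * #B * (#B - k) := by
    have : (0 : ℝ) ≤ #B - k := by linarith
    positivity
  have hδk : (δ : ℝ) ≤ k := by
    have : δ < k := by rw [hδ]; exact Nat.mod_lt _ hk
    exact_mod_cast this.le
  have hδ0 : (0 : ℝ) ≤ δ := by positivity
  have hδ' : (0 : ℝ) ≤ δ * (k - δ) := mul_nonneg hδ0 (by linarith)
  refine div_le_div_of_nonneg_right ?_ hD
  nlinarith [mul_nonneg hc'.le hδ']

/-- **Theorem 3.1 (ii), third printed inequality:**
`(|A|²|B|² − δ₀² − |A + B|(k|A||B| − δ₀))/(|A + B||B|(|B| − k)) ≥ |A|(|A||B| − k|A + B|)/(|A + B|(|B| − k))`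
(uses only `0 ≤ δ₀ < |A + B|`). [cite: Grynkiewicz2009, Thm 3.1 (ii)] -/
theorem thm31_ii_real'' (hkB : k < #B) (δ₀ : ℕ) (hδ₀ : δ₀ < #(A + B)) :
    (#A : ℝ) * (#A * #B - k * #(A + B)) / (#(A + B) * (#B - k)) ≤
      ((#A : ℝ) ^ 2 * #B ^ 2 - δ₀ ^ 2 - #(A + B) * (k * #A * #B - δ₀))
        / (#(A + B) * #B * (#B - k)) := by
  have hB : (0 : ℝ) < #B := by exact_mod_cast (show 0 < #B by omega)
  have hkB' : (k : ℝ) < #B := by exact_mod_cast hkB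
  have hc' : (0 : ℝ) < #(A + B) := by exact_mod_cast (show 0 < #(A + B) by omega)
  have hδ₀' : (δ₀ : ℝ) ≤ #(A + B) := by exact_mod_cast hδ₀.le
  have hδ₀0 : (0 : ℝ) ≤ δ₀ := by positivity
  have hBk : (0 : ℝ) < #B - k := by linarith
  have hD1 : (0 : ℝ) < #(A + B) * (#B - k) := by positivity
  have hD2 : (0 : ℝ) < #(A + B) * #B * (#B - k) := by positivity
  rw [div_le_div_iff₀ hD1 hD2]
  have hδ : (0 : ℝ) ≤ δ₀ * (#(A + B) - δ₀) := mul_nonneg hδ₀0 (by linarith)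
  have key : (#A : ℝ) * (#A * #B - k * #(A + B)) * #B ≤
      (#A : ℝ) ^ 2 * #B ^ 2 - δ₀ ^ 2 - #(A + B) * (k * #A * #B - δ₀) := by nlinarith
  calc (#A : ℝ) * (#A * #B - k * #(A + B)) * (#(A + B) * #B * (#B - k))
      = ((#A : ℝ) * (#A * #B - k * #(A + B)) * #B) * (#(A + B) * (#B - k)) := by ring
    _ ≤ ((#A : ℝ) ^ 2 * #B ^ 2 - δ₀ ^ 2 - #(A + B) * (k * #A * #B - δ₀)) * (#(A + B) * (#B - k)) :=
        mul_le_mul_of_nonneg_right key hD1.le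

/-- **Theorem 3.1 (iii) as printed, for every `d ≥ 1`:**
`|A + B| ≥ 2|A||B|/(d + 1) − M/(d(d + 1))` (display (14) without the minimum; the printed (iii) is the
instance `d = ⌊(M + |A||B|)/|A||B|⌋`, see `thm31_iii_real_floor`). [cite: Grynkiewicz2009, Thm 3.1 (iii)] -/
theorem thm31_iii_real (hkB : k ≤ #B) (hTA : #T ≤ #A)
    (hrep : ∀ x ∉ T, A.addConvolution (-B) x ≤ k) (d : ℕ) (hd : 1 ≤ d)
    (δ : ℕ) (hδ : δ = #B * (#A - #T) % k) (M : ℝ)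
    (hM : M = (#T : ℝ) * #B * (#B - k) + (k - 1) * #A * #B - δ * (k - δ)) :
    2 * (#A : ℝ) * #B / (d + 1) - M / (d * (d + 1)) ≤ #(A + B) := by
  have h := thm31_iii A B T k hkB hTA hrep d
  have hcast := cast_greedyBound_eq_M_add A B T k hTA δ hδ M hM
  have hd' : (1 : ℝ) ≤ d := by exact_mod_cast hd
  have hd1 : (0 : ℝ) < d + 1 := by linarith
  have hd2 : (0 : ℝ) < d * (d + 1) := by positivity
  have h' : (((2 * d + 1) * (#A * #B) : ℕ) : ℝ) ≤
      ((#T * #B ^ 2 + (#A * #B - #T * #B) / k * k ^ 2 + ((#A * #B - #T * #B) % k) ^ 2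
        + #(A + B) * (d * (d + 1)) : ℕ) : ℝ) := by exact_mod_cast h
  rw [Nat.cast_add (#T * #B ^ 2 + _ + _), hcast] at h'
  push_cast at h'
  have key : 2 * (#A : ℝ) * #B * d - M ≤ #(A + B) * (d * (d + 1)) := by linarith
  calc 2 * (#A : ℝ) * #B / (d + 1) - M / (d * (d + 1))
      = (2 * (#A : ℝ) * #B * d - M) / (d * (d + 1)) := by
        field_simp
    _ ≤ #(A + B) * (d * (d + 1)) / (d * (d + 1)) := by gcongr
    _ = #(A + B) := by field_simp

/-- **Theorem 3.1 (iii), the printed instance:** with `d = ⌊(M + |A||B|)/|A||B|⌋` (a natural number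
`≥ 1`, since `M ≥ 0`): `⌊(M + 2|A||B|)/|A||B|⌋ = d + 1` and
`|A + B| ≥ 2|A||B|/(d + 1) − M/(d(d + 1))`, i.e. the printed
`|A + B| ≥ 2|A||B|/⌊(M + 2|A||B|)/|A||B|⌋ − M/(⌊(M + |A||B|)/|A||B|⌋ ⌊(M + 2|A||B|)/|A||B|⌋)`.
[cite: Grynkiewicz2009, Thm 3.1 (iii)] -/
theorem thm31_iii_real_floor (hk : 1 ≤ k) (hkB : k < #B) (hBA : #B ≤ #A) (hTA : #T ≤ #A)
    (hrep : ∀ x ∉ T, A.addConvolution (-B) x ≤ k)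
    (δ : ℕ) (hδ : δ = #B * (#A - #T) % k) (M : ℝ)
    (hM : M = (#T : ℝ) * #B * (#B - k) + (k - 1) * #A * #B - δ * (k - δ)) :
    1 ≤ ⌊(M + #A * #B) / (#A * #B)⌋₊ ∧
      ⌊(M + 2 * #A * #B) / (#A * #B)⌋₊ = ⌊(M + #A * #B) / (#A * #B)⌋₊ + 1 ∧
      2 * (#A : ℝ) * #B / ⌊(M + 2 * #A * #B) / (#A * #B)⌋₊
          - M / (⌊(M + #A * #B) / (#A * #B)⌋₊ * ⌊(M + 2 * #A * #B) / (#A * #B)⌋₊) ≤ #(A + B) := by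
  have hM0 := printedM_nonneg A B T k hk hkB hBA δ hδ M hM
  have hB : (0 : ℝ) < #B := by exact_mod_cast (show 0 < #B by omega)
  have hA : (0 : ℝ) < #A := by exact_mod_cast (show 0 < #A by omega)
  have hab : (0 : ℝ) < #A * #B := by positivity
  set d := ⌊(M + #A * #B) / (#A * #B)⌋₊ with hd
  have hd1 : 1 ≤ d := by
    rw [hd, Nat.one_le_floor_iff, le_div_iff₀ hab]
    linarith
  have hfloor : ⌊(M + 2 * #A * #B) / (#A * #B)⌋₊ = d + 1 := by
    rw [hd, ← Nat.floor_add_one (div_nonneg (by linarith) hab.le)]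
    congr 1
    field_simp
    ring
  refine ⟨hd1, hfloor, ?_⟩
  rw [hfloor]
  push_cast
  exact thm31_iii_real A B T k hkB.le hTA hrep d hd1 δ hδ M hM

/-- The closed form of the printed (iii): if `x` is the integer with `1 ≤ x ≤ |A||B|` and
`M + x ≡ 0 mod |A||B|`, then `d := ⌊(M + |A||B|)/|A||B|⌋ = (M + x)/|A||B|` and
`2|A||B|/(d + 1) − M/(d(d + 1)) = |A|²|B|²(M + 2x)/((M + |A||B| + x)(M + x))` — recorded as the
algebraic identity for real `M`, `N = |A||B| > 0` and `d N = M + x > 0`.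
[cite: Grynkiewicz2009, Thm 3.1 (iii)] -/
theorem thm31_iii_closed_form (M N x d : ℝ) (hN : 0 < N) (hMx : 0 < M + x) (hd : d * N = M + x) :
    2 * N / (d + 1) - M / (d * (d + 1)) = N ^ 2 * (M + 2 * x) / ((M + N + x) * (M + x)) := by
  have hd' : d = (M + x) / N := by rw [← hd]; field_simp
  have hdpos : 0 < d := by rw [hd']; positivity
  have hMNx : 0 < M + N + x := by linarith
  have h1 : d + 1 = (M + N + x) / N := by rw [hd']; field_simp; ring
  rw [h1, hd']
  field_simp
  ring

end Printed

/-! ### §3-E.  The opening remark: the Sidon bound from Theorem 3.1 (iii) -/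

section Sidon
variable {G : Type*} [AddCommGroup G] [DecidableEq G]

/-- For a Sidon set `A` (`a + b = c + d` with `a, b, c, d ∈ A` forces `{a, b} = {c, d}`, spelled out
as in `SidonSetsErdosTuran`), every non-zero difference has at most one representation:
`r_{A,−A}(x) ≤ 1` for `x ≠ 0`. [cite: Grynkiewicz2009, §3 (opening remark)] -/
theorem addConvolution_neg_le_one_of_sidon {A : Finset G}
    (hS : ∀ a ∈ A, ∀ b ∈ A, ∀ c ∈ A, ∀ d ∈ A, a + b = c + d → a = c ∨ a = d) :
    ∀ x ∉ ({0} : Finset G), A.addConvolution (-A) x ≤ 1 := by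
  intro x hx
  rw [mem_singleton] at hx
  rw [← card_inter_vadd, card_le_one]
  intro u hu v hv
  rw [mem_inter, mem_vadd_finset] at hu hv
  obtain ⟨hu, u', hu', rfl⟩ := hu
  obtain ⟨hv, v', hv', rfl⟩ := hv
  -- `(x + u') + v' = (x + v') + u'` with all four in `A`
  have := hS (x +ᵥ u') hu v' hv' (x +ᵥ v') hv u' hu' (by simp [vadd_eq_add]; abel)
  rcases this with h | h
  · exact h
  · exfalso; apply hx
    have : x + u' = u' := h
    simpa using this

/-- **The Sidon bound from Theorem 3.1 (iii)** («if `A = B`, `|T| = 1` and `k = 1` … then the familiar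
bound `|A + A| ≥ |A|(|A| + 1)/2` follows from Theorem 3.1 (iii) by noting that `x = |A|`»): for a
Sidon set `A`, `|A|(|A| + 1) ≤ 2|A + A|`. [cite: Grynkiewicz2009, §3 (opening remark)] -/
theorem card_mul_succ_le_two_mul_card_add_of_sidon {A : Finset G}
    (hS : ∀ a ∈ A, ∀ b ∈ A, ∀ c ∈ A, ∀ d ∈ A, a + b = c + d → a = c ∨ a = d) :
    #A * (#A + 1) ≤ 2 * #(A + A) := by
  rcases A.eq_empty_or_nonempty with rfl | hA
  · simp
  have h1 : 1 ≤ #A := card_pos.2 hA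
  -- Theorem 3.1 (iii) with `B = A`, `T = {0}`, `k = 1`, `d = 1`
  have h := thm31_iii A A {0} 1 h1 (by simpa using h1) (addConvolution_neg_le_one_of_sidon hS) 1
  simp only [card_singleton, one_mul, Nat.div_one, one_pow, mul_one, Nat.mod_one] at h
  have hsub : #A * #A - #A + #A = #A * #A := Nat.sub_add_cancel (Nat.le_mul_self _)
  nlinarith [h, hsub]

end Sidon

end Literature.Combinatorics.Additive.Grynkiewicz2009
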